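import Summits.HodgeConjecture.CorCM.MultiFieldWeilNetTheoremAllKinds
import Summits.HodgeConjecture.CorCM.MultiFieldWeilDihedralDecicsGroupedMeet
import HarnessLib

/-!
# MULTI-FIELD WEIL ENGINE — THE NET THEOREM OF ALL KINDS WITH FREENESS BY INSPECTION (dihedral fields: τ-parts different and sharing a τ-embedding), and the isogeny-closed form

Cell `pub-hodgecm2` (COR-CM), seat b30 gen 43 (2026-08-26); count-neutral own lane MULTI-FIELD WEIL ENGINE (stem `MultiFieldWeil*`), two corollaries of
`CorCM/MultiFieldWeilNetTheoremAllKinds.lean` (F7):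
* **`hodgeConjectureFor_biproduct_sigma_allKinds_of_shapes_meet`** (+ dominated): the dihedral clause of F7 (FREENESS stated on automorphisms of `ℂ`) replaced by data READ OFF
  THE TYPES — over a dihedral decic field carrying two structures, their `τ`-parts are DIFFERENT and SHARE a `τ`-embedding (different axes on the pentagon; gen 42's
  `comp_eq_of_stab_of_meet_family`, `CorCM/MultiFieldWeilDihedralDecicsGroupedMeet.lean`); sextic simplicity discharged (primed form).
* **`hodgeConjectureFor_biproduct_of_isIsogenous_sigma_allKinds_of_shapes`**: the isogeny-closed form of F7 (every product of varieties each isogenous to `E` or to some `B j t`).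
Theorems only; no definition, no named fact, no `sorry`.  HONEST FRAMING: conditional ONLY on the two displayed Markman binders; `HC_CM` is NOT proved and not asserted.
[cite: Markman2025SurveySecant, Thm. 1.2] [cite: Markman2025SecantWeil, Thm 1.5.1] [cite: Shimura1998, §6.1 Corollary of Theorem 2, §8.2 Prop. 26, §18.2 Lemma (i)]
[cite: Serre1977, §2.3 Ex. 2.6; §5.3] [cite: DixonMortimer1996, §1.4 Ex. 1.4.1–1.4.2; §1.6, Thm. 1.6A; §2.1; §3.3] [cite: Lang2002, VI §1 Thm. 1.1; XIII §4] [cite: MumfordAV1970, §19]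

## References
* [Markman2025SurveySecant] E. Markman, arXiv:2509.23403, Thm. 1.2.  [Markman2025SecantWeil] E. Markman, Cycles on abelian 2n-folds of Weil type from secant sheaves on abelian
  n-folds, Thm 1.5.1.  [Shimura1998] G. Shimura, *Abelian varieties with complex multiplication and modular functions*, §6.1, §8.2, §18.2.  [Serre1977] J.-P. Serre, *Linear
  Representations of Finite Groups*, GTM 42, §2.3, §5.3.  [DixonMortimer1996] J. D. Dixon, B. Mortimer, *Permutation Groups*, GTM 163.  [Lang2002] S. Lang, *Algebra*,
  GTM 211.  [MumfordAV1970] D. Mumford, *Abelian Varieties*, §19.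
-/

noncomputable section

open CategoryTheory CategoryTheory.Limits NumberField IntermediateField

namespace Summit.HodgeConjecture.CorCM.MultiFieldWeil

open Finset
open Literature.AlgebraicGeometry Literature.AlgebraicGeometry.Motives Literature.AlgebraicGeometry.HodgeTheory
open Literature.AlgebraicGeometry.ComplexMultiplication (IsCMTypeRealisation)
open Literature.AlgebraicTopology.SingularHomology
open Literature.NumberTheory.ComplexMultiplication

open scoped Classical

section Meet

variable {J : Type} [Fintype J] {KJ : J → Type} [fK : ∀ j, Field (KJ j)] [nK : ∀ j, NumberField (KJ j)] [cK : ∀ j, IsCMField (KJ j)]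
  {k : Type} [fk : Field k] [nk : NumberField k] [ck : IsCMField k] {τ : k →+* ℂ} {c : J → ℕ}
  {B : ∀ j : J, Fin (c j) → AbelianVariety ℂ} {Ψ : ∀ j : J, Fin (c j) → CMType (KJ j)}
  {ιB : ∀ (j : J) (t : Fin (c j)), 𝓞 (KJ j) →+* End (B j t)} {θB : ∀ (j : J) (t : Fin (c j)), KJ j →+* Module.End ℂ (complexBetti (B j t).X 1)}
  {E : AbelianVariety ℂ} {Φ₀ : CMType k} {ιE : 𝓞 k →+* End E} {θE : k →+* Module.End ℂ (complexBetti E.X 1)}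

/-- **THE NET THEOREM OF ALL KINDS WITH FREENESS BY INSPECTION.**  F7's `hodgeConjectureFor_biproduct_sigma_allKinds_of_shapes'` with the dihedral freeness clause replaced by:
the `τ`-parts of the two types over a dihedral decic field are DIFFERENT and SHARE a `τ`-embedding.  `HC_CM` is NOT asserted. [cite: Markman2025SurveySecant, Thm. 1.2]
[cite: Markman2025SecantWeil, Thm 1.5.1] [cite: Shimura1998, §18.2 Lemma (i)] [cite: Serre1977, §5.3] [cite: DixonMortimer1996, §1.4 Ex. 1.4.1–1.4.2; §1.6, Thm. 1.6A; §3.3] -/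
theorem hodgeConjectureFor_biproduct_sigma_allKinds_of_shapes_meet (hW4 : Markman2025_weilClasses_algebraic_abelianFourfold)
    (hM6 : Markman2025_weilClasses_algebraic_hyperbolicSixfold) (h2 : Module.finrank ℚ k = 2) (iK : ∀ j : J, k →+* KJ j) (nJ : J → ℕ)
    (hdeg : ∀ j, Module.finrank ℚ (KJ j) = 2 * nJ j) (hB : ∀ j t, IsCMTypeRealisation (Ψ j t) (B j t) (ιB j t) (θB j t))
    (hE : IsCMTypeRealisation Φ₀ E ιE θE) (hΦ₀ : ∀ σ : k →+* ℂ, σ ∈ Φ₀.1 ↔ σ = τ) (tJ dJ : J → Prop)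
    (hcnt : ∀ j t, (nJ j = 3 ∧ (Finset.univ.filter fun s : KJ j →+* ℂ => s.comp (iK j) = τ ∧ s ∈ (Ψ j t).1).card = 1) ∨
      (nJ j = 4 ∧ (Finset.univ.filter fun s : KJ j →+* ℂ => s.comp (iK j) = τ ∧ s ∈ (Ψ j t).1).card = 1) ∨
      (nJ j = 4 ∧ (Finset.univ.filter fun s : KJ j →+* ℂ => s.comp (iK j) = τ ∧ s ∈ (Ψ j t).1).card = 2) ∨
      (nJ j = 5 ∧ (Finset.univ.filter fun s : KJ j →+* ℂ => s.comp (iK j) = τ ∧ s ∈ (Ψ j t).1).card = 2))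
    (hni : ∀ j t t', t ≠ t' → ¬ AbelianVariety.IsIsogenous (B j t) (B j t'))
    (hone : ∀ j, nJ j = 4 → ¬ tJ j → c j ≤ 1 ∧ ∀ t, (Finset.univ.filter fun s : KJ j →+* ℂ => s.comp (iK j) = τ ∧ s ∈ (Ψ j t).1).card = 1)
    (hc3 : ∀ j, nJ j = 3 → c j ≤ 2) (hc4 : ∀ j, nJ j = 4 → c j ≤ 3) (hc5 : ∀ j, nJ j = 5 → c j ≤ 4)
    (hsep : ∀ j, nJ j = 4 → ∀ t₁ t₂ t₃ : Fin (c j), t₁ ≠ t₂ → (Finset.univ.filter fun u : KJ j →+* ℂ => u.comp (iK j) = τ ∧ u ∈ (Ψ j t₁).1).card = 1 →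
      (Finset.univ.filter fun u : KJ j →+* ℂ => u.comp (iK j) = τ ∧ u ∈ (Ψ j t₂).1).card = 1 →
      (Finset.univ.filter fun u : KJ j →+* ℂ => u.comp (iK j) = τ ∧ u ∈ (Ψ j t₃).1).card = 2 →
      ∀ s₁ s₂ : KJ j →+* ℂ, s₁.comp (iK j) = τ → s₂.comp (iK j) = τ → s₁ ∈ (Ψ j t₁).1 → s₂ ∈ (Ψ j t₂).1 → (s₁ ∈ (Ψ j t₃).1 ↔ s₂ ∉ (Ψ j t₃).1))
    (hmeet : ∀ j, nJ j = 5 → c j = 4 → ∀ t : Fin (c j), ∃ t', t' ≠ t ∧ ∃ s : KJ j →+* ℂ, s.comp (iK j) = τ ∧ s ∈ (Ψ j t).1 ∧ s ∈ (Ψ j t').1)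
    (hodd : ∀ j, nJ j = 5 → c j = 4 → ∃ s : KJ j →+* ℂ, s.comp (iK j) = τ ∧ (Finset.univ.filter fun t : Fin (c j) => s ∈ (Ψ j t).1).card ≠ 0 ∧
      (Finset.univ.filter fun t : Fin (c j) => s ∈ (Ψ j t).1).card ≠ 2)
    (h24 : ∀ j, nJ j = 4 → tJ j → ∃ s₀ t₀ : KJ j →+* ℂ, s₀.comp (iK j) = τ ∧ t₀.comp (iK j) = τ ∧ s₀ ≠ t₀ ∧
      Module.finrank ℚ ↥(adjoin ℚ (Set.range τ) ⊔ adjoin ℚ (Set.range s₀ ∪ Set.range t₀)) = 24)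
    (h40 : ∀ j, nJ j = 5 → ¬ dJ j → 1 < c j → ∃ s₀ t₀ : KJ j →+* ℂ, s₀.comp (iK j) = τ ∧ t₀.comp (iK j) = τ ∧ s₀ ≠ t₀ ∧
      Module.finrank ℚ ↥(adjoin ℚ (Set.range τ) ⊔ adjoin ℚ (Set.range s₀ ∪ Set.range t₀)) = 40)
    (hdihJ : ∀ j, dJ j → nJ j = 5 ∧ c j ≤ 2 ∧ Module.finrank ℚ ↥(normalClosure ℚ (KJ j) ℂ) ≤ 20 ∧
      (∃ s₀ t₀ : KJ j →+* ℂ, s₀.comp (iK j) = τ ∧ t₀.comp (iK j) = τ ∧ ∃ x, t₀ x ∉ adjoin ℚ (Set.range s₀)) ∧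
      ∀ t t' : Fin (c j), t ≠ t' →
        (Finset.univ.filter fun s : KJ j →+* ℂ => s.comp (iK j) = τ ∧ s ∈ (Ψ j t).1) ≠ (Finset.univ.filter fun s : KJ j →+* ℂ => s.comp (iK j) = τ ∧ s ∈ (Ψ j t').1) ∧
        ∃ s : KJ j →+* ℂ, s.comp (iK j) = τ ∧ s ∈ (Ψ j t).1 ∧ s ∈ (Ψ j t').1)
    (hiso : ∀ j j' : J, j' ≠ j → nJ j = nJ j' → (nJ j' = 4 → tJ j' ∧ tJ j) → IsEmpty (KJ j' →+* KJ j))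
    (hint : ∀ j : J, nJ j = 4 → ¬ tJ j → ∃ (F : Type) (_ : Field F) (_ : NumberField F) (iF : k →+* F) (jF : F →+* KJ j), Module.finrank ℚ F = 4 ∧ jF.comp iF = iK j)
    (hdisj : ∀ j j' : J, j' ≠ j → nJ j' = 4 → ¬ tJ j' → nJ j = 4 → ¬ tJ j → ∃ s : KJ j' →+* ℂ, s.comp (iK j') = τ ∧
      Module.finrank ℚ ↥(normalClosure ℚ (KJ j) ℂ ⊔ adjoin ℚ (Set.range s)) = Module.finrank ℚ ↥(normalClosure ℚ (KJ j) ℂ) * 4)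
    {N : ℕ} (κ : Fin N → Option ((j : J) × Fin (c j))) :
    HodgeConjectureFor (⨁ fun l => ((κ l).elim E fun x => B x.1 x.2 : AbelianVariety ℂ)).dim (⨁ fun l => ((κ l).elim E fun x => B x.1 x.2 : AbelianVariety ℂ)).X := by
  refine hodgeConjectureFor_biproduct_sigma_allKinds_of_shapes' hW4 hM6 h2 iK nJ hdeg hB hE hΦ₀ tJ dJ hcnt hni hone hc3 hc4 hc5 hsep hmeet hodd h24 h40
    (fun j hd => ?_) hiso hint hdisj κ
  obtain ⟨h5, hc2, h20, hns, hmt⟩ := hdihJ j hd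
  refine ⟨h5, hc2, h20, hns, fun hcj ρ hρ hst s hs => ?_⟩
  have hcnt5 : ∀ t : Fin (c j), (Finset.univ.filter fun u : KJ j →+* ℂ => u.comp (iK j) = τ ∧ u ∈ (Ψ j t).1).card = 2 := fun t => by
    rcases hcnt j t with ⟨h, -⟩ | ⟨h, -⟩ | ⟨h, -⟩ | ⟨-, h⟩
    · omega
    · omega
    · omega
    · exact h
  have htt : (⟨0, by omega⟩ : Fin (c j)) ≠ ⟨1, hcj⟩ := fun h => absurd (congrArg Fin.val h) (by norm_num)
  exact comp_eq_of_stab_of_meet_family h2 (iK j) (by rw [hdeg j, h5]) h20 hns (Ψ j) hcnt5 (hmt _ _ htt).1 (hmt _ _ htt).2 ρ hρ hst s hs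

/-- **Dominated form.** [cite: Markman2025SecantWeil, Thm 1.5.1] [cite: MumfordAV1970, §19 Thm. 1 and p. 169] -/
theorem hodgeConjectureFor_of_avDominatedBy_sigma_allKinds_of_shapes_meet (hW4 : Markman2025_weilClasses_algebraic_abelianFourfold)
    (hM6 : Markman2025_weilClasses_algebraic_hyperbolicSixfold) (h2 : Module.finrank ℚ k = 2) (iK : ∀ j : J, k →+* KJ j) (nJ : J → ℕ)
    (hdeg : ∀ j, Module.finrank ℚ (KJ j) = 2 * nJ j) (hB : ∀ j t, IsCMTypeRealisation (Ψ j t) (B j t) (ιB j t) (θB j t))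
    (hE : IsCMTypeRealisation Φ₀ E ιE θE) (hΦ₀ : ∀ σ : k →+* ℂ, σ ∈ Φ₀.1 ↔ σ = τ) (tJ dJ : J → Prop)
    (hcnt : ∀ j t, (nJ j = 3 ∧ (Finset.univ.filter fun s : KJ j →+* ℂ => s.comp (iK j) = τ ∧ s ∈ (Ψ j t).1).card = 1) ∨
      (nJ j = 4 ∧ (Finset.univ.filter fun s : KJ j →+* ℂ => s.comp (iK j) = τ ∧ s ∈ (Ψ j t).1).card = 1) ∨
      (nJ j = 4 ∧ (Finset.univ.filter fun s : KJ j →+* ℂ => s.comp (iK j) = τ ∧ s ∈ (Ψ j t).1).card = 2) ∨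
      (nJ j = 5 ∧ (Finset.univ.filter fun s : KJ j →+* ℂ => s.comp (iK j) = τ ∧ s ∈ (Ψ j t).1).card = 2))
    (hni : ∀ j t t', t ≠ t' → ¬ AbelianVariety.IsIsogenous (B j t) (B j t'))
    (hone : ∀ j, nJ j = 4 → ¬ tJ j → c j ≤ 1 ∧ ∀ t, (Finset.univ.filter fun s : KJ j →+* ℂ => s.comp (iK j) = τ ∧ s ∈ (Ψ j t).1).card = 1)
    (hc3 : ∀ j, nJ j = 3 → c j ≤ 2) (hc4 : ∀ j, nJ j = 4 → c j ≤ 3) (hc5 : ∀ j, nJ j = 5 → c j ≤ 4)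
    (hsep : ∀ j, nJ j = 4 → ∀ t₁ t₂ t₃ : Fin (c j), t₁ ≠ t₂ → (Finset.univ.filter fun u : KJ j →+* ℂ => u.comp (iK j) = τ ∧ u ∈ (Ψ j t₁).1).card = 1 →
      (Finset.univ.filter fun u : KJ j →+* ℂ => u.comp (iK j) = τ ∧ u ∈ (Ψ j t₂).1).card = 1 →
      (Finset.univ.filter fun u : KJ j →+* ℂ => u.comp (iK j) = τ ∧ u ∈ (Ψ j t₃).1).card = 2 →
      ∀ s₁ s₂ : KJ j →+* ℂ, s₁.comp (iK j) = τ → s₂.comp (iK j) = τ → s₁ ∈ (Ψ j t₁).1 → s₂ ∈ (Ψ j t₂).1 → (s₁ ∈ (Ψ j t₃).1 ↔ s₂ ∉ (Ψ j t₃).1))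
    (hmeet : ∀ j, nJ j = 5 → c j = 4 → ∀ t : Fin (c j), ∃ t', t' ≠ t ∧ ∃ s : KJ j →+* ℂ, s.comp (iK j) = τ ∧ s ∈ (Ψ j t).1 ∧ s ∈ (Ψ j t').1)
    (hodd : ∀ j, nJ j = 5 → c j = 4 → ∃ s : KJ j →+* ℂ, s.comp (iK j) = τ ∧ (Finset.univ.filter fun t : Fin (c j) => s ∈ (Ψ j t).1).card ≠ 0 ∧
      (Finset.univ.filter fun t : Fin (c j) => s ∈ (Ψ j t).1).card ≠ 2)
    (h24 : ∀ j, nJ j = 4 → tJ j → ∃ s₀ t₀ : KJ j →+* ℂ, s₀.comp (iK j) = τ ∧ t₀.comp (iK j) = τ ∧ s₀ ≠ t₀ ∧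
      Module.finrank ℚ ↥(adjoin ℚ (Set.range τ) ⊔ adjoin ℚ (Set.range s₀ ∪ Set.range t₀)) = 24)
    (h40 : ∀ j, nJ j = 5 → ¬ dJ j → 1 < c j → ∃ s₀ t₀ : KJ j →+* ℂ, s₀.comp (iK j) = τ ∧ t₀.comp (iK j) = τ ∧ s₀ ≠ t₀ ∧
      Module.finrank ℚ ↥(adjoin ℚ (Set.range τ) ⊔ adjoin ℚ (Set.range s₀ ∪ Set.range t₀)) = 40)
    (hdihJ : ∀ j, dJ j → nJ j = 5 ∧ c j ≤ 2 ∧ Module.finrank ℚ ↥(normalClosure ℚ (KJ j) ℂ) ≤ 20 ∧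
      (∃ s₀ t₀ : KJ j →+* ℂ, s₀.comp (iK j) = τ ∧ t₀.comp (iK j) = τ ∧ ∃ x, t₀ x ∉ adjoin ℚ (Set.range s₀)) ∧
      ∀ t t' : Fin (c j), t ≠ t' →
        (Finset.univ.filter fun s : KJ j →+* ℂ => s.comp (iK j) = τ ∧ s ∈ (Ψ j t).1) ≠ (Finset.univ.filter fun s : KJ j →+* ℂ => s.comp (iK j) = τ ∧ s ∈ (Ψ j t').1) ∧
        ∃ s : KJ j →+* ℂ, s.comp (iK j) = τ ∧ s ∈ (Ψ j t).1 ∧ s ∈ (Ψ j t').1)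
    (hiso : ∀ j j' : J, j' ≠ j → nJ j = nJ j' → (nJ j' = 4 → tJ j' ∧ tJ j) → IsEmpty (KJ j' →+* KJ j))
    (hint : ∀ j : J, nJ j = 4 → ¬ tJ j → ∃ (F : Type) (_ : Field F) (_ : NumberField F) (iF : k →+* F) (jF : F →+* KJ j), Module.finrank ℚ F = 4 ∧ jF.comp iF = iK j)
    (hdisj : ∀ j j' : J, j' ≠ j → nJ j' = 4 → ¬ tJ j' → nJ j = 4 → ¬ tJ j → ∃ s : KJ j' →+* ℂ, s.comp (iK j') = τ ∧
      Module.finrank ℚ ↥(normalClosure ℚ (KJ j) ℂ ⊔ adjoin ℚ (Set.range s)) = Module.finrank ℚ ↥(normalClosure ℚ (KJ j) ℂ) * 4)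
    {N : ℕ} (κ : Fin N → Option ((j : J) × Fin (c j))) {X : AbelianVariety ℂ}
    (hX : Domination.AVDominatedBy X (⨁ fun l => ((κ l).elim E fun x => B x.1 x.2 : AbelianVariety ℂ))) : HodgeConjectureFor X.dim X.X :=
  Domination.hodgeConjectureFor_of_avDominatedBy
    (hodgeConjectureFor_biproduct_sigma_allKinds_of_shapes_meet hW4 hM6 h2 iK nJ hdeg hB hE hΦ₀ tJ dJ hcnt hni hone hc3 hc4 hc5 hsep hmeet hodd h24 h40 hdihJ hiso
      hint hdisj κ) hX

/-- **Isogeny-closed form of F7**: every product of complex abelian varieties each ISOGENOUS to `E` or to some `B j t` (any multiplicities, any order).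
[cite: Markman2025SurveySecant, Thm. 1.2] [cite: Markman2025SecantWeil, Thm 1.5.1] [cite: MumfordAV1970, §19] -/
theorem hodgeConjectureFor_biproduct_of_isIsogenous_sigma_allKinds_of_shapes (hW4 : Markman2025_weilClasses_algebraic_abelianFourfold)
    (hM6 : Markman2025_weilClasses_algebraic_hyperbolicSixfold) (h2 : Module.finrank ℚ k = 2) (iK : ∀ j : J, k →+* KJ j) (nJ : J → ℕ)
    (hdeg : ∀ j, Module.finrank ℚ (KJ j) = 2 * nJ j) (hB : ∀ j t, IsCMTypeRealisation (Ψ j t) (B j t) (ιB j t) (θB j t))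
    (hE : IsCMTypeRealisation Φ₀ E ιE θE) (hΦ₀ : ∀ σ : k →+* ℂ, σ ∈ Φ₀.1 ↔ σ = τ) (tJ dJ : J → Prop)
    (hS : ∀ j, nJ j = 3 → ∀ t, (B j t).IsSimple)
    (hcnt : ∀ j t, (nJ j = 3 ∧ (Finset.univ.filter fun s : KJ j →+* ℂ => s.comp (iK j) = τ ∧ s ∈ (Ψ j t).1).card = 1) ∨
      (nJ j = 4 ∧ (Finset.univ.filter fun s : KJ j →+* ℂ => s.comp (iK j) = τ ∧ s ∈ (Ψ j t).1).card = 1) ∨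
      (nJ j = 4 ∧ (Finset.univ.filter fun s : KJ j →+* ℂ => s.comp (iK j) = τ ∧ s ∈ (Ψ j t).1).card = 2) ∨
      (nJ j = 5 ∧ (Finset.univ.filter fun s : KJ j →+* ℂ => s.comp (iK j) = τ ∧ s ∈ (Ψ j t).1).card = 2))
    (hni : ∀ j t t', t ≠ t' → ¬ AbelianVariety.IsIsogenous (B j t) (B j t'))
    (hone : ∀ j, nJ j = 4 → ¬ tJ j → c j ≤ 1 ∧ ∀ t, (Finset.univ.filter fun s : KJ j →+* ℂ => s.comp (iK j) = τ ∧ s ∈ (Ψ j t).1).card = 1)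
    (hc3 : ∀ j, nJ j = 3 → c j ≤ 2) (hc4 : ∀ j, nJ j = 4 → c j ≤ 3) (hc5 : ∀ j, nJ j = 5 → c j ≤ 4)
    (hsep : ∀ j, nJ j = 4 → ∀ t₁ t₂ t₃ : Fin (c j), t₁ ≠ t₂ → (Finset.univ.filter fun u : KJ j →+* ℂ => u.comp (iK j) = τ ∧ u ∈ (Ψ j t₁).1).card = 1 →
      (Finset.univ.filter fun u : KJ j →+* ℂ => u.comp (iK j) = τ ∧ u ∈ (Ψ j t₂).1).card = 1 →
      (Finset.univ.filter fun u : KJ j →+* ℂ => u.comp (iK j) = τ ∧ u ∈ (Ψ j t₃).1).card = 2 →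
      ∀ s₁ s₂ : KJ j →+* ℂ, s₁.comp (iK j) = τ → s₂.comp (iK j) = τ → s₁ ∈ (Ψ j t₁).1 → s₂ ∈ (Ψ j t₂).1 → (s₁ ∈ (Ψ j t₃).1 ↔ s₂ ∉ (Ψ j t₃).1))
    (hmeet : ∀ j, nJ j = 5 → c j = 4 → ∀ t : Fin (c j), ∃ t', t' ≠ t ∧ ∃ s : KJ j →+* ℂ, s.comp (iK j) = τ ∧ s ∈ (Ψ j t).1 ∧ s ∈ (Ψ j t').1)
    (hodd : ∀ j, nJ j = 5 → c j = 4 → ∃ s : KJ j →+* ℂ, s.comp (iK j) = τ ∧ (Finset.univ.filter fun t : Fin (c j) => s ∈ (Ψ j t).1).card ≠ 0 ∧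
      (Finset.univ.filter fun t : Fin (c j) => s ∈ (Ψ j t).1).card ≠ 2)
    (h24 : ∀ j, nJ j = 4 → tJ j → ∃ s₀ t₀ : KJ j →+* ℂ, s₀.comp (iK j) = τ ∧ t₀.comp (iK j) = τ ∧ s₀ ≠ t₀ ∧
      Module.finrank ℚ ↥(adjoin ℚ (Set.range τ) ⊔ adjoin ℚ (Set.range s₀ ∪ Set.range t₀)) = 24)
    (h40 : ∀ j, nJ j = 5 → ¬ dJ j → 1 < c j → ∃ s₀ t₀ : KJ j →+* ℂ, s₀.comp (iK j) = τ ∧ t₀.comp (iK j) = τ ∧ s₀ ≠ t₀ ∧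
      Module.finrank ℚ ↥(adjoin ℚ (Set.range τ) ⊔ adjoin ℚ (Set.range s₀ ∪ Set.range t₀)) = 40)
    (hdihJ : ∀ j, dJ j → nJ j = 5 ∧ c j ≤ 2 ∧ Module.finrank ℚ ↥(normalClosure ℚ (KJ j) ℂ) ≤ 20 ∧
      (∃ s₀ t₀ : KJ j →+* ℂ, s₀.comp (iK j) = τ ∧ t₀.comp (iK j) = τ ∧ ∃ x, t₀ x ∉ adjoin ℚ (Set.range s₀)) ∧
      (1 < c j → ∀ ρ : ℂ ≃+* ℂ, (ρ : ℂ →+* ℂ).comp τ = τ →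
        (∀ (t : Fin (c j)) (s : KJ j →+* ℂ), s.comp (iK j) = τ → (s ∈ (Ψ j t).1 ↔ (ρ : ℂ →+* ℂ).comp s ∈ (Ψ j t).1)) →
        ∀ s : KJ j →+* ℂ, s.comp (iK j) = τ → (ρ : ℂ →+* ℂ).comp s = s))
    (hiso : ∀ j j' : J, j' ≠ j → nJ j = nJ j' → (nJ j' = 4 → tJ j' ∧ tJ j) → IsEmpty (KJ j' →+* KJ j))
    (hint : ∀ j : J, nJ j = 4 → ¬ tJ j → ∃ (F : Type) (_ : Field F) (_ : NumberField F) (iF : k →+* F) (jF : F →+* KJ j), Module.finrank ℚ F = 4 ∧ jF.comp iF = iK j)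
    (hdisj : ∀ j j' : J, j' ≠ j → nJ j' = 4 → ¬ tJ j' → nJ j = 4 → ¬ tJ j → ∃ s : KJ j' →+* ℂ, s.comp (iK j') = τ ∧
      Module.finrank ℚ ↥(normalClosure ℚ (KJ j) ℂ ⊔ adjoin ℚ (Set.range s)) = Module.finrank ℚ ↥(normalClosure ℚ (KJ j) ℂ) * 4)
    {N : ℕ} (X : Fin N → AbelianVariety ℂ)
    (hX : ∀ l, ∃ y : Option ((j : J) × Fin (c j)), AbelianVariety.IsIsogenous (X l) ((y.elim E fun x => B x.1 x.2 : AbelianVariety ℂ))) :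
    HodgeConjectureFor (⨁ X).dim (⨁ X).X := by
  choose κ hκ using hX
  exact Domination.hodgeConjectureFor_of_avDominatedBy
    (hodgeConjectureFor_biproduct_sigma_allKinds_of_shapes hW4 hM6 h2 iK nJ hdeg hB hE hΦ₀ tJ dJ hS hcnt hni hone hc3 hc4 hc5 hsep hmeet hodd h24 h40 hdihJ hiso hint
      hdisj κ)
    (Domination.AVDominatedBy.of_isIsogenous (AbelianVariety.IsIsogenous.biproduct hκ) (Domination.AVDominatedBy.refl _))

end Meet

end Summit.HodgeConjecture.CorCM.MultiFieldWeil

end
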